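/-
Soloist programme `solo-KontsevichZagierPeriods-blind`, session 3.
THE STUFFLE (HARMONIC) PRODUCT AS A KZ MOVE: `ζ(2)·ζ(2) = 2ζ(2,2) + ζ(4)` is integrand additivity on
the 4-cube plus one coordinate permutation.
-/
import Summits.KontsevichZagierPeriods.KontsevichZagierPeriods.Theorems.SoloBlindMZVBox
import Summits.KontsevichZagierPeriods.KontsevichZagierPeriods.Theorems.SoloBlindZetaTwoReps
import HarnessLib

/-!
# The stuffle product inside the rules: `ζ(2)ζ(2) = 2ζ(2,2) + ζ(4)`

The *stuffle* (harmonic, quasi-shuffle) product of multiple zeta values, `ζ(a)ζ(b) = ζ(a,b) +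
ζ(b,a) + ζ(a+b)`, is proved on the series side by splitting `∑_{m,n} = ∑_{m>n} + ∑_{m<n} + ∑_{m=n}`.
On Kontsevich's simplex representations it is invisible; but on the **box representations** of
`SoloBlindMZVBox` it becomes a *rational-function identity*, i.e. an instance of Kontsevich–Zagier's
rule (1) (additivity of the integrand).  With `a = x₀x₁`, `b = x₂x₃` on the cube `(0,1)⁴`:

  `1/((1-a)(1-b)) = a/((1-a)(1-ab)) + b/((1-b)(1-ab)) + 1/(1-ab)`,

and the three summands are the integrands of `B_(2,2)`, of `B_(2,2)` with the coordinate pairs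
swapped, and of Beukers' `B₄`.  Hence:

* `kz_stuffle_two_two : of (B₂ × B₂) - 2 • of B_(2,2) - of B₄ ∈ relations` — **four moves**:
  two integrand-additivity moves, one coordinate permutation `(x₀,x₁,x₂,x₃) ↦ (x₂,x₃,x₀,x₁)`
  (a change of variables with `|det| = 1`), and nothing else (`B₂ × B₂ = [(0,1)⁴,
  1/((1-x₀x₁)(1-x₂x₃))]` *is* the Fubini product representation);
* `kz_stuffle_two_two_simplex` — the same for Kontsevich's simplices `Λ₂ × Λ₂`, `Λ_(2,2)`, `Λ₄`
  (through `kz_zeta_box_simplex`, `kz_mzv_box`);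
* `zeta_two_sq_eq` — the real-number identity `ζ(2)² = 2ζ(2,2) + ζ(4)`, read off from the moves.
-/

noncomputable section

namespace Summit.KontsevichZagierPeriods.KontsevichZagierPeriods.Theorems

open Set MeasureTheory
open Literature.ModelTheory.ExponentialFields (IsSemialgebraic)
open MvPolynomial (aeval X)
open Literature.NumberTheory.Transcendental
open Literature.NumberTheory.Transcendental.KZ

namespace SoloBlind

/-! ## The four representations on the cube `(0,1)⁴` -/

/-- `(2,2)` is admissible. -/
theorem isAdmissible_two_two : MZV.IsAdmissible [2, 2] := ⟨by decide, fun _ => le_rfl⟩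

/-- `ε(2,2) = 0101`. -/
theorem binaryWord_two_two : MZV.binaryWord [2, 2] = [false, true, false, true] := by decide

/-- Beukers' `B₂ = [(0,1)², 1/(1-x₀x₁)]`. -/
def boxTwo : IntegralRep 2 := boxZetaRep 2 le_rfl

/-- Beukers' `B₄ = [(0,1)⁴, 1/(1-x₀x₁x₂x₃)]`. -/
def boxFour : IntegralRep 4 := boxZetaRep 4 (by norm_num)

/-- `B_(2,2) = [(0,1)⁴, x₀x₁/((1-x₀x₁)(1-x₀x₁x₂x₃))]`. -/
def boxTwoTwo : IntegralRep 4 := boxMZVRep [2, 2] isAdmissible_two_two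

/-- On the cube, `0 < 1 - x₂x₃`. -/
theorem one_sub_mul_pos_of_mem_kzOpenBox {x : Fin 4 → ℝ} (hx : x ∈ kzOpenBox 4) (i j : Fin 4) :
    0 < 1 - x i * x j := by
  have hi := hx i
  have hj := hx j
  nlinarith [hi.1, hi.2, hj.1, hj.2, mul_pos hi.1 hj.1]

/-- On the cube, `0 < 1 - x₀x₁x₂x₃`. -/
theorem one_sub_prod_four_pos_of_mem_kzOpenBox {x : Fin 4 → ℝ} (hx : x ∈ kzOpenBox 4) :
    0 < 1 - x 0 * x 1 * x 2 * x 3 := by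
  have h01 := one_sub_mul_pos_of_mem_kzOpenBox hx 0 1
  have h23 := one_sub_mul_pos_of_mem_kzOpenBox hx 2 3
  have h0 := hx 0; have h1 := hx 1; have h2 := hx 2; have h3 := hx 3
  have ha : 0 < x 0 * x 1 := mul_pos h0.1 h1.1
  have hb : 0 < x 2 * x 3 := mul_pos h2.1 h3.1
  nlinarith [mul_pos ha hb]

/-- `R_{0101}(x) = x₀x₁/((1-x₀x₁)(1-x₀x₁x₂x₃))` (for `x₀, x₂ ≠ 0`). -/
theorem boxWordIntegrand_two_two {x : Fin 4 → ℝ} (hx0 : x 0 ≠ 0) (hx2 : x 2 ≠ 0) :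
    boxWordIntegrand [false, true, false, true] 4 x =
      x 0 * x 1 / ((1 - x 0 * x 1) * (1 - x 0 * x 1 * x 2 * x 3)) := by
  have h1 : headProd x 1 = x 0 := by
    rw [headProd_succ x (show 0 < 4 by norm_num), headProd_zero, mul_one]; rfl
  have h2 : headProd x 2 = x 0 * x 1 := by
    rw [headProd_succ x (show 1 < 4 by norm_num), h1, mul_comm]; rfl
  have h3 : headProd x 3 = x 0 * x 1 * x 2 := by
    rw [headProd_succ x (show 2 < 4 by norm_num), h2, mul_comm]; rfl
  have h4 : headProd x 4 = x 0 * x 1 * x 2 * x 3 := by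
    rw [headProd_succ x (show 3 < 4 by norm_num), h3, mul_comm]; rfl
  simp only [boxWordIntegrand, Fin.prod_univ_four, Fin.val_zero, Fin.val_one, Fin.val_two,
    (show ((3 : Fin 4) : ℕ) = 3 from rfl), List.getD_cons_zero, List.getD_cons_succ, if_true,
    Bool.false_eq_true, if_false, h1, h2, h3, h4, zero_add]
  field_simp

/-- The integrand of `B_(2,2)` on the cube. -/
theorem boxTwoTwo_integrand {x : Fin 4 → ℝ} (hx : x ∈ kzOpenBox 4) :
    boxTwoTwo.integrand x = x 0 * x 1 / ((1 - x 0 * x 1) * (1 - x 0 * x 1 * x 2 * x 3)) := by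
  show boxWordIntegrand (MZV.binaryWord [2, 2]) 4 x = _
  rw [binaryWord_two_two]
  exact boxWordIntegrand_two_two (hx 0).1.ne' (hx 2).1.ne'

/-- The domain of `B_(2,2)` is the cube. -/
theorem boxTwoTwo_domain : boxTwoTwo.domain = kzOpenBox 4 := rfl

/-- The integrand of `B₄` on the cube. -/
theorem boxFour_integrand (x : Fin 4 → ℝ) :
    boxFour.integrand x = 1 / (1 - x 0 * x 1 * x 2 * x 3) := by
  show 1 / (1 - ∏ i, x i) = _
  rw [Fin.prod_univ_four]

/-- **`B₂ × B₂ = [(0,1)⁴, 1/((1-x₀x₁)(1-x₂x₃))]`**: the domain of the Fubini product is the cube. -/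
theorem boxTwo_prod_domain : (boxTwo.prod boxTwo).domain = kzOpenBox 4 := by
  ext z
  simp only [IntegralRep.prod_domain, IntegralRep.mem_prodDomain, boxTwo, boxZetaRep,
    mem_kzOpenBox]
  constructor
  · rintro ⟨h1, h2⟩ i
    fin_cases i
    · exact h1 0
    · exact h1 1
    · exact h2 0
    · exact h2 1
  · intro h
    exact ⟨fun i => by fin_cases i <;> [exact h 0; exact h 1],
      fun j => by fin_cases j <;> [exact h 2; exact h 3]⟩

/-- … and its integrand is the product. -/
theorem boxTwo_prod_integrand (z : Fin 4 → ℝ) :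
    (boxTwo.prod boxTwo).integrand z = 1 / (1 - z 0 * z 1) * (1 / (1 - z 2 * z 3)) := by
  rw [IntegralRep.prod_integrand_eq, IntegralRep.prodFun_apply]
  simp only [boxTwo, boxZetaRep, Fin.prod_univ_two,
    (show (Fin.castAdd 2 (0 : Fin 2) : Fin 4) = 0 from rfl),
    (show (Fin.castAdd 2 (1 : Fin 2) : Fin 4) = 1 from rfl),
    (show (Fin.natAdd 2 (0 : Fin 2) : Fin 4) = 2 from rfl),
    (show (Fin.natAdd 2 (1 : Fin 2) : Fin 4) = 3 from rfl)]

/-- The coordinate permutation `(0 2)(1 3)` of `Fin 4`. -/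
def swapPairs : Fin 4 ≃ Fin 4 := (Equiv.swap 0 2).trans (Equiv.swap 1 3)

/-- Its values. -/
theorem swapPairs_apply :
    swapPairs 0 = 2 ∧ swapPairs 1 = 3 ∧ swapPairs 2 = 0 ∧ swapPairs 3 = 1 := by decide

/-- `B_(2,2)` with the coordinate pairs swapped: `[(0,1)⁴, x₂x₃/((1-x₂x₃)(1-x₀x₁x₂x₃))]`. -/
def boxTwoTwoSwap : IntegralRep 4 := boxTwoTwo.reindex swapPairs

/-- Its domain is the cube. -/
theorem boxTwoTwoSwap_domain : boxTwoTwoSwap.domain = kzOpenBox 4 := by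
  ext w
  simp only [boxTwoTwoSwap, IntegralRep.reindex_domain, boxTwoTwo_domain, mem_setOf_eq,
    mem_kzOpenBox]
  exact ⟨fun h i => by simpa using h (swapPairs.symm i), fun h i => h _⟩

/-- Its integrand on the cube. -/
theorem boxTwoTwoSwap_integrand {w : Fin 4 → ℝ} (hw : w ∈ kzOpenBox 4) :
    boxTwoTwoSwap.integrand w = w 2 * w 3 / ((1 - w 2 * w 3) * (1 - w 0 * w 1 * w 2 * w 3)) := by
  obtain ⟨e0, e1, e2, e3⟩ := swapPairs_apply
  have hw' : (fun i => w (swapPairs i)) ∈ kzOpenBox 4 := fun i => hw _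
  simp only [boxTwoTwoSwap, IntegralRep.reindex_integrand]
  rw [boxTwoTwo_integrand hw']
  simp only [e0, e1, e2, e3]
  ring

/-- The auxiliary representation `M = [(0,1)⁴, 1/((1-x₂x₃)(1-x₀x₁x₂x₃))]` (`= B₂×B₂ - B_(2,2)
= B_(2,2)^swap + B₄` as integrands). -/
def boxMid : IntegralRep 4 :=
  ratRep (kzOpenBox 4) (fun x => 1 / ((1 - x 2 * x 3) * (1 - x 0 * x 1 * x 2 * x 3))) 1
    ((1 - X 2 * X 3) * (1 - X 0 * X 1 * X 2 * X 3)) (isSemialgebraic_kzOpenBox 4)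
    (fun x hx => by
      simpa using (mul_pos (one_sub_mul_pos_of_mem_kzOpenBox hx 2 3)
        (one_sub_prod_four_pos_of_mem_kzOpenBox hx)).ne')
    (fun x _ => by simp)
    (by
      have hb := boxTwoTwoSwap.integrableOn
      have hc := boxFour.integrableOn
      rw [boxTwoTwoSwap_domain] at hb
      change IntegrableOn boxFour.integrand (kzOpenBox 4) at hc
      refine (hb.add hc).congr_fun (fun x hx => ?_) (measurableSet_kzOpenBox 4)
      rw [Pi.add_apply, boxTwoTwoSwap_integrand hx, boxFour_integrand]
      have h23 := (one_sub_mul_pos_of_mem_kzOpenBox hx 2 3).ne'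
      have h4 := (one_sub_prod_four_pos_of_mem_kzOpenBox hx).ne'
      field_simp
      ring)

/-! ## The moves -/

/-- Move 1 (integrand additivity): `B₂×B₂ = B_(2,2) + M` on the cube —
`1/((1-a)(1-b)) = a/((1-a)(1-ab)) + 1/((1-b)(1-ab))`. -/
theorem prod_sub_twoTwo_sub_mid :
    of (boxTwo.prod boxTwo) - of boxTwoTwo - of boxMid ∈ relations := by
  refine of_sub_sub_mem_relations_of_add (boxTwoTwo_domain.trans boxTwo_prod_domain.symm)
    ((ratRep_domain).trans boxTwo_prod_domain.symm) fun x hx => ?_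
  rw [boxTwo_prod_domain] at hx
  rw [boxTwo_prod_integrand, boxTwoTwo_integrand hx]
  show _ = _ + 1 / ((1 - x 2 * x 3) * (1 - x 0 * x 1 * x 2 * x 3))
  have h01 := (one_sub_mul_pos_of_mem_kzOpenBox hx 0 1).ne'
  have h23 := (one_sub_mul_pos_of_mem_kzOpenBox hx 2 3).ne'
  have h4 := (one_sub_prod_four_pos_of_mem_kzOpenBox hx).ne'
  field_simp
  ring

/-- Move 2 (integrand additivity): `M = B_(2,2)^swap + B₄` on the cube —
`1/((1-b)(1-ab)) = b/((1-b)(1-ab)) + 1/(1-ab)`. -/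
theorem mid_sub_swap_sub_four : of boxMid - of boxTwoTwoSwap - of boxFour ∈ relations := by
  refine of_sub_sub_mem_relations_of_add boxTwoTwoSwap_domain rfl fun x hx => ?_
  change x ∈ kzOpenBox 4 at hx
  rw [boxTwoTwoSwap_integrand hx, boxFour_integrand]
  show 1 / ((1 - x 2 * x 3) * (1 - x 0 * x 1 * x 2 * x 3)) = _
  have h23 := (one_sub_mul_pos_of_mem_kzOpenBox hx 2 3).ne'
  have h4 := (one_sub_prod_four_pos_of_mem_kzOpenBox hx).ne'
  field_simp
  ring

/-- Move 3 (change of variables): the coordinate permutation `(x₀,x₁,x₂,x₃) ↦ (x₂,x₃,x₀,x₁)`. -/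
theorem twoTwo_sub_swap : of boxTwoTwo - of boxTwoTwoSwap ∈ relations :=
  of_sub_of_reindex_mem_relations _ _

/-- **The stuffle product `ζ(2)ζ(2) = 2ζ(2,2) + ζ(4)` inside the rules**: on the cube `(0,1)⁴`,
`[B₂ × B₂] - 2·[B_(2,2)] - [B₄]` is a relation — two integrand-additivity moves and one coordinate
permutation, all with `ℚ`-rational data. -/
theorem kz_stuffle_two_two :
    of (boxTwo.prod boxTwo) - 2 • of boxTwoTwo - of boxFour ∈ relations := by
  have h := sub_mem (add_mem prod_sub_twoTwo_sub_mid mid_sub_swap_sub_four) twoTwo_sub_swap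
  convert h using 1
  rw [two_nsmul]
  abel

/-! ## Consequences -/

/-- In `Q`: `[B₂]² = 2·[B_(2,2)] + [B₄]`. -/
theorem mkQ_boxTwo_sq :
    mkQ (of boxTwo) * mkQ (of boxTwo) = 2 • mkQ (of boxTwoTwo) + mkQ (of boxFour) := by
  rw [← mkQ_mul, of_mul_of, ← map_nsmul, ← map_add, mkQ_eq_mkQ_iff]
  simpa [sub_sub] using kz_stuffle_two_two

/-- **`ζ(2)² = 2ζ(2,2) + ζ(4)`**, read off from the moves (soundness of the calculus, the values
`∫ B_n = ζ(n)` and `∫ B_s = ζ(s)`). -/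
theorem zeta_two_sq_eq : zetaValue 2 ^ 2 = 2 * multipleZeta [2, 2] + zetaValue 4 := by
  have h := relations_le_ker_eval_holds kz_stuffle_two_two
  rw [AddMonoidHom.mem_ker, map_sub, map_sub, map_nsmul, eval_of, eval_of, eval_of,
    IntegralRep.value_prod] at h
  rw [show boxTwo.value = zetaValue 2 from boxZetaRep_value _,
    show boxTwoTwo.value = multipleZeta [2, 2] from boxMZVRep_value _ _,
    show boxFour.value = zetaValue 4 from boxZetaRep_value _] at h
  simp only [nsmul_eq_mul, Nat.cast_ofNat] at h
  linear_combination h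

/-- **The stuffle on Kontsevich's simplices**: `[Λ₂ × Λ₂] - 2·[Λ_(2,2)] - [Λ₄]` is a relation
(box ≡ simplex for each factor: `kz_zeta_box_simplex`, `kz_mzv_box`). -/
theorem kz_stuffle_two_two_simplex :
    of ((simplexZetaRep 2 le_rfl).prod (simplexZetaRep 2 le_rfl)) -
      2 • of (mzvSimplexRep [2, 2] isAdmissible_two_two) - of (simplexZetaRep 4 (by norm_num)) ∈
      relations := by
  have h2 : mkQ (of boxTwo) = mkQ (of (simplexZetaRep 2 le_rfl)) :=
    mkQ_eq_mkQ_iff.mpr (kz_zeta_box_simplex le_rfl)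
  have h22 : mkQ (of boxTwoTwo) = mkQ (of (mzvSimplexRep [2, 2] isAdmissible_two_two)) :=
    mkQ_eq_mkQ_iff.mpr (kz_mzv_box _ _)
  have h4 : mkQ (of boxFour) = mkQ (of (simplexZetaRep 4 (by norm_num))) :=
    mkQ_eq_mkQ_iff.mpr (kz_zeta_box_simplex _)
  have h := mkQ_boxTwo_sq
  rw [h2, h22, h4, ← mkQ_mul, of_mul_of, ← map_nsmul, ← map_add, mkQ_eq_mkQ_iff] at h
  simpa [sub_sub] using h

end SoloBlind

end Summit.KontsevichZagierPeriods.KontsevichZagierPeriods.Theorems
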